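import Literature.Computability.Complexity.DeterminantFP
import Literature.Computability.Complexity.IrreducibilityLLLPolyArith
import Mathlib.RingTheory.Polynomial.Resultant.Basic
import HarnessLib

/-!
# The resultants of Trager's norm method on coefficient lists (Landau 1985 §1; Cohen Alg. 3.6.4)

Support file for the discharge of the named fact
`Literature.NumberTheory.NumberFields.nfIso_mem_P` (number-field isomorphism is in `P`;
Landau 1985, A. K. Lenstra 1983 Thm. (3.7)). The isomorphism test computes, for monic
`p, q ∈ ℤ[X]` and a multiplier `c`, the norm polynomial `N_c(X) = Res_Y(q(Y), p(X − cY))`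
(Cohen 1993, Alg. 3.6.4 step 3: "`N(X) ← R_Y(T(Y), A(X − kY))`"; Landau 1985, Thm. 1.4) — in the
integer form proved adequate by `Literature.Computability.Complexity.nfIsomorphic_iff_of_norm_values`:
an integer polynomial of degree `≤ deg p · deg q` whose values at `x₀ = 0, …, deg p · deg q` are
the INTEGER resultants `Res_Y(q(Y), p(x₀ − cY))`. This file supplies

* `pcompLin p x₀ c` — the coefficient list of `p(x₀ − cY) ∈ ℤ[Y]` by Horner's rule on lists
  (`ofCoeffs_pcompLin`), with a length bound;
* `sylv f g m n` — the Sylvester matrix with plain indices (`= Polynomial.sylvester`,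
  `sylv_eq_sylvester`, `det_sylv`), `sylvRows fl gl m n` — its rows computed from coefficient
  lists (`sylvRows_eq_rows`), and `resVal fl gl m n := IntDetFP.detZ (sylvRows fl gl m n)` —
  **the integer resultant through the tree's polynomial-time determinant** (`resVal_eq`:
  `= resultant (ofCoeffs fl) (ofCoeffs gl) m n`, by `IntDetFP.detZ_rows`);
* the SYMBOLIC norm `normSym p q c = Res_Y(q(Y), p(X − cY)) ∈ ℤ[X]` (a resultant over the ring
  `ℤ[X]`; never computed, it certifies that the interpolation of the sequel file is exact):
  `eval_normSym` (its value at an integer `t` is the integer resultant `Res_Y(q, p(t − cY))`,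
  resultants commute with ring maps) and `natDegree_normSym_le` (`deg ≤ deg q · deg p`, by the
  Leibniz expansion: the `deg q` columns of `p(X − cY)`-coefficients have entries of degree
  `≤ deg p`, the other columns are constant).

## References

* S. Landau, *Factoring polynomials over algebraic number fields*, SIAM J. Comput. 14 (1985)
  184–195, §1 (Thm. 1.4: `Norm(f) = Res_y(m(y), f(x, y))`). [Landau1985]
* H. Cohen, *A Course in Computational Algebraic Number Theory*, GTM 138, Springer 1993, §3.3.2
  (resultants and Sylvester's matrix), §3.6.2, Alg. 3.6.4. [Cohen1993]
* B. M. Trager, *Algebraic factoring and rational function integration*, SYMSAC '76, 219–226.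
-/

open Polynomial Finset

namespace Literature.NumberTheory.NumberFields

open Literature.Computability.Complexity Literature.Computability.Complexity.SumcheckMA
open Literature.LinearAlgebra.Matrix

/-! ### `p(x₀ − cY)` on coefficient lists -/

/-- The coefficient list (in `Y`) of `p(x₀ − cY)`, by Horner's rule:
`a :: rest ↦ [a] + (x₀ − cY) · rest(x₀ − cY)`. [cite: Cohen1993, Alg. 3.6.4 step 3 (the substitution X − kY)] -/
def pcompLin (p : List ℤ) (x0 c : ℤ) : List ℤ :=
  p.foldr (fun a acc => padd [a] (pmul acc [x0, -c])) []

/-- `ofCoeffs (a :: l) = a + X · ofCoeffs l`. [folklore] -/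
theorem ofCoeffs_cons (a : ℤ) (l : List ℤ) : ofCoeffs (a :: l) = C a + X * ofCoeffs l := rfl

/-- The list `[x₀, −c]` is the linear polynomial `x₀ − cX`. [folklore] -/
theorem ofCoeffs_lin (x0 c : ℤ) : ofCoeffs [x0, -c] = C x0 - C c * X := by
  rw [ofCoeffs_cons, ofCoeffs_singleton, C_neg]
  ring

/-- **`pcompLin` computes the substitution**: `ofCoeffs (pcompLin p x₀ c) = p(x₀ − cX)`.
[cite: Cohen1993, Alg. 3.6.4 step 3] -/
theorem ofCoeffs_pcompLin (p : List ℤ) (x0 c : ℤ) :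
    ofCoeffs (pcompLin p x0 c) = (ofCoeffs p).comp (C x0 - C c * X) := by
  induction p with
  | nil => simp [pcompLin, ofCoeffs]
  | cons a p ih =>
    show ofCoeffs (padd [a] (pmul (pcompLin p x0 c) [x0, -c])) = _
    rw [ofCoeffs_padd, ofCoeffs_pmul, ih, ofCoeffs_lin, ofCoeffs_singleton, ofCoeffs_cons, add_comp,
      C_comp, mul_comp, X_comp]
    ring

/-- `|pcompLin p x₀ c| ≤ 2 |p|`. [folklore] -/
theorem length_pcompLin_le (p : List ℤ) (x0 c : ℤ) : (pcompLin p x0 c).length ≤ 2 * p.length := by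
  induction p with
  | nil => simp [pcompLin]
  | cons a p ih =>
    show (padd [a] (pmul (pcompLin p x0 c) [x0, -c])).length ≤ 2 * (a :: p).length
    rw [length_padd, List.length_cons]
    have := length_pmul_le (pcompLin p x0 c) [x0, -c]
    simp only [List.length_cons, List.length_nil] at this ⊢
    omega

/-! ### The Sylvester matrix with plain indices -/

section Sylv

variable {R : Type*} [CommRing R]

/-- Entry `(i, j)` of the Sylvester matrix of `(f, g)` with formal degrees `(m, n)` (Mathlib's
column convention): the first `m` columns carry the coefficients of `g` (`g_{i-j}` on the window
`j ≤ i ≤ j + n`), the last `n` columns those of `f`. [cite: Cohen1993, §3.3.2 (Sylvester's matrix)] -/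
def sylvEntry (f g : R[X]) (m n i j : ℕ) : R :=
  if j < m then (if j ≤ i ∧ i ≤ j + n then g.coeff (i - j) else 0)
  else (if j - m ≤ i ∧ i ≤ j - m + m then f.coeff (i - (j - m)) else 0)

/-- The Sylvester matrix with plain indices. [cite: Cohen1993, §3.3.2] -/
def sylv (f g : R[X]) (m n : ℕ) : Matrix (Fin (m + n)) (Fin (m + n)) R :=
  Matrix.of fun i j => sylvEntry f g m n i j

/-- Entries of `sylv`. [folklore] -/
@[simp] theorem sylv_apply (f g : R[X]) (m n : ℕ) (i j : Fin (m + n)) :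
    sylv f g m n i j = sylvEntry f g m n i j := rfl

/-- `sylv` is Mathlib's `Polynomial.sylvester`. [folklore] -/
theorem sylv_eq_sylvester (f g : R[X]) (m n : ℕ) : sylv f g m n = sylvester f g m n := by
  ext i j
  rw [sylv_apply, sylvester, Matrix.of_apply]
  induction j using Fin.addCases with
  | left j₁ =>
    rw [Fin.addCases_left, sylvEntry, Fin.val_castAdd, if_pos j₁.isLt]
    simp only [Set.mem_Icc]
  | right j₁ =>
    rw [Fin.addCases_right, sylvEntry, Fin.val_natAdd, if_neg (by omega), Nat.add_sub_cancel_left]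
    simp only [Set.mem_Icc]

/-- `det (sylv f g m n) = Res(f, g)` (formal degrees `m, n`). [cite: Cohen1993, §3.3.2 (Def. 3.3.2: the resultant as a determinant)] -/
theorem det_sylv (f g : R[X]) (m n : ℕ) : (sylv f g m n).det = resultant f g m n := by
  rw [sylv_eq_sylvester, resultant]

end Sylv

/-! ### The Sylvester rows on coefficient lists, and the resultant through `detZ` -/

/-- Entry `(i, j)` read off the coefficient lists. [cite: Cohen1993, §3.3.2] -/
def sylvEntryL (fl gl : List ℤ) (m n i j : ℕ) : ℤ :=
  if j < m then (if j ≤ i ∧ i ≤ j + n then gl.getD (i - j) 0 else 0)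
  else (if j - m ≤ i ∧ i ≤ j - m + m then fl.getD (i - (j - m)) 0 else 0)

/-- The list of rows of the Sylvester matrix of `(ofCoeffs fl, ofCoeffs gl)` with formal degrees
`(m, n)` — the input of the tree's determinant program `IntDetFP.detZ`. [cite: Cohen1993, §3.3.2] -/
def sylvRows (fl gl : List ℤ) (m n : ℕ) : List (List ℤ) :=
  (List.range (m + n)).map fun i => (List.range (m + n)).map fun j => sylvEntryL fl gl m n i j

/-- The list entries are the matrix entries. [folklore] -/
theorem sylvEntryL_eq (fl gl : List ℤ) (m n i j : ℕ) :
    sylvEntryL fl gl m n i j = sylvEntry (ofCoeffs fl) (ofCoeffs gl) m n i j := by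
  simp only [sylvEntryL, sylvEntry, coeff_ofCoeffs]

/-- Number of rows. [folklore] -/
@[simp] theorem length_sylvRows (fl gl : List ℤ) (m n : ℕ) : (sylvRows fl gl m n).length = m + n := by
  simp [sylvRows]

/-- **`sylvRows` is the row list of `sylv`.** [folklore] -/
theorem sylvRows_eq_rows (fl gl : List ℤ) (m n : ℕ) :
    sylvRows fl gl m n = Berkowitz.rows (sylv (ofCoeffs fl) (ofCoeffs gl) m n) := by
  unfold sylvRows Berkowitz.rows
  refine List.ext_getElem (by simp) fun i h₁ h₂ => ?_
  rw [List.getElem_map, List.getElem_range, List.getElem_ofFn]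
  refine List.ext_getElem (by simp) fun j h₃ h₄ => ?_
  rw [List.getElem_map, List.getElem_range, List.getElem_ofFn, sylv_apply, sylvEntryL_eq]

/-- **The integer resultant as computed by the machine**: the tree's polynomial-time determinant
`IntDetFP.detZ` of the Sylvester rows. [cite: Cohen1993, §3.3.2 and Alg. 3.6.4 step 3] -/
def resVal (fl gl : List ℤ) (m n : ℕ) : ℤ := IntDetFP.detZ (sylvRows fl gl m n)

/-- **`resVal` is the resultant** `Res(ofCoeffs fl, ofCoeffs gl)` with formal degrees `(m, n)`
(`IntDetFP.detZ_rows`: the determinant program is exact on integer matrices). [cite: Cohen1993, §3.3.2] -/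
theorem resVal_eq (fl gl : List ℤ) (m n : ℕ) :
    resVal fl gl m n = resultant (ofCoeffs fl) (ofCoeffs gl) m n := by
  rw [resVal, sylvRows_eq_rows, IntDetFP.detZ_rows, det_sylv]

/-! ### Coefficient degrees of bivariate integer polynomials -/

/-- All `Y`-coefficients of `A ∈ ℤ[X][Y]` have `X`-degree `≤ d`. [folklore] -/
def CoeffDegLE (A : ℤ[X][X]) (d : ℕ) : Prop := ∀ e, (A.coeff e).natDegree ≤ d

/-- Monotonicity in the bound. [folklore] -/
theorem CoeffDegLE.mono {A : ℤ[X][X]} {d e : ℕ} (h : CoeffDegLE A d) (hde : d ≤ e) : CoeffDegLE A e :=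
  fun k => (h k).trans hde

/-- Sums. [folklore] -/
theorem CoeffDegLE.add {A B : ℤ[X][X]} {d : ℕ} (hA : CoeffDegLE A d) (hB : CoeffDegLE B d) :
    CoeffDegLE (A + B) d := fun k => by
  rw [coeff_add]
  exact (natDegree_add_le _ _).trans (max_le (hA k) (hB k))

/-- Differences. [folklore] -/
theorem CoeffDegLE.sub {A B : ℤ[X][X]} {d : ℕ} (hA : CoeffDegLE A d) (hB : CoeffDegLE B d) :
    CoeffDegLE (A - B) d := fun k => by
  rw [coeff_sub]
  exact (natDegree_sub_le _ _).trans (max_le (hA k) (hB k))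

/-- Finite sums. [folklore] -/
theorem CoeffDegLE.sum {ι : Type*} (s : Finset ι) {f : ι → ℤ[X][X]} {d : ℕ}
    (h : ∀ i ∈ s, CoeffDegLE (f i) d) : CoeffDegLE (∑ i ∈ s, f i) d := fun k => by
  rw [finsetSum_coeff]
  exact natDegree_sum_le_of_forall_le _ _ fun i hi => h i hi k

/-- Products: the bounds add. [folklore] -/
theorem CoeffDegLE.mul {A B : ℤ[X][X]} {d e : ℕ} (hA : CoeffDegLE A d) (hB : CoeffDegLE B e) :
    CoeffDegLE (A * B) (d + e) := fun k => by
  rw [coeff_mul]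
  refine natDegree_sum_le_of_forall_le _ _ fun x _ => ?_
  exact natDegree_mul_le.trans (Nat.add_le_add (hA x.1) (hB x.2))

/-- The unit. [folklore] -/
theorem coeffDegLE_one : CoeffDegLE (1 : ℤ[X][X]) 0 := fun k => by
  rw [coeff_one]
  split_ifs <;> simp

/-- Powers. [folklore] -/
theorem CoeffDegLE.pow {A : ℤ[X][X]} {d : ℕ} (hA : CoeffDegLE A d) : ∀ k : ℕ, CoeffDegLE (A ^ k) (k * d)
  | 0 => by rw [pow_zero, zero_mul]; exact coeffDegLE_one
  | k + 1 => by
    rw [pow_succ, Nat.succ_mul]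
    exact (CoeffDegLE.pow hA k).mul hA

/-- Constants `C r`, `r ∈ ℤ[X]`. [folklore] -/
theorem coeffDegLE_C (r : ℤ[X]) : CoeffDegLE (C r) r.natDegree := fun k => by
  rw [coeff_C]
  split_ifs <;> simp

/-- The variable `Y`. [folklore] -/
theorem coeffDegLE_X : CoeffDegLE (X : ℤ[X][X]) 0 := fun k => by
  rw [coeff_X]
  split_ifs <;> simp

/-! ### The symbolic norm polynomial `Res_Y(q(Y), p(X − cY)) ∈ ℤ[X]` -/

/-- `p(X − cY)` as a polynomial in `Y` with coefficients in `ℤ[X]`. [cite: Cohen1993, Alg. 3.6.4 step 3] [cite: Landau1985, §1 (Thm. 1.4)] -/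
noncomputable def shiftPoly (p : ℤ[X]) (c : ℤ) : ℤ[X][X] :=
  p.eval₂ (C.comp C) (C (X : ℤ[X]) - C (C c) * (X : ℤ[X][X]))

/-- **The symbolic norm polynomial** `N_c(X) = Res_Y(q(Y), p(X − cY))`, a resultant over the ring
`ℤ[X]` with the formal degrees `deg q`, `deg p`. [cite: Landau1985, §1 (Thm. 1.4: Norm = Res_y(m(y), f(x,y)))] [cite: Cohen1993, Alg. 3.6.4 step 3] -/
noncomputable def normSym (p q : ℤ[X]) (c : ℤ) : ℤ[X] :=
  resultant (q.map C) (shiftPoly p c) q.natDegree p.natDegree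

/-- Specialising `X ↦ t` in `p(X − cY)` gives `p(t − cY)`. [folklore] -/
theorem map_shiftPoly_evalRingHom (p : ℤ[X]) (c t : ℤ) :
    (shiftPoly p c).map (evalRingHom t) = p.comp (C t - C c * X) := by
  rw [shiftPoly, ← coe_mapRingHom, hom_eval₂]
  have h1 : (mapRingHom (evalRingHom t)).comp (C.comp C) = (C : ℤ →+* ℤ[X]) := by
    ext a
    simp
  have h2 : (mapRingHom (evalRingHom t)) (C (X : ℤ[X]) - C (C c) * (X : ℤ[X][X])) = C t - C c * X := by
    simp
  rw [h1, h2]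
  rfl

/-- **The values of the symbolic norm are the integer resultants**:
`N_c(t) = Res_Y(q(Y), p(t − cY))` for every integer `t` (resultants commute with ring maps).
[cite: Cohen1993, §3.3.2 and Alg. 3.6.4 step 3] -/
theorem eval_normSym (p q : ℤ[X]) (c t : ℤ) :
    (normSym p q c).eval t = resultant q (p.comp (C t - C c * X)) q.natDegree p.natDegree := by
  have h := resultant_map_map (q.map C) (shiftPoly p c) q.natDegree p.natDegree (evalRingHom t)
  have hq : (q.map C).map (evalRingHom t) = q := by
    rw [Polynomial.map_map]
    have : (evalRingHom t).comp C = RingHom.id ℤ := by ext a; simp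
    rw [this, Polynomial.map_id]
  rw [hq, map_shiftPoly_evalRingHom] at h
  rw [normSym, ← coe_evalRingHom, ← h]

/-- The coefficients of `p(X − cY)` (in `Y`) have `X`-degree `≤ deg p`. [folklore] -/
theorem coeffDegLE_shiftPoly (p : ℤ[X]) (c : ℤ) : CoeffDegLE (shiftPoly p c) p.natDegree := by
  rw [shiftPoly, eval₂_eq_sum, Polynomial.sum_def]
  refine CoeffDegLE.sum _ fun k hk => ?_
  have hL : CoeffDegLE (C (X : ℤ[X]) - C (C c) * (X : ℤ[X][X])) 1 := by
    refine CoeffDegLE.sub ((coeffDegLE_C _).mono natDegree_X_le) ?_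
    have := (coeffDegLE_C (C c : ℤ[X])).mul coeffDegLE_X
    rw [natDegree_C] at this
    exact this.mono (by omega)
  have hpow := hL.pow k
  rw [mul_one] at hpow
  have hC : CoeffDegLE ((C.comp C) (p.coeff k) : ℤ[X][X]) 0 := by
    have := coeffDegLE_C (C (p.coeff k) : ℤ[X])
    rw [natDegree_C] at this
    exact this
  have := hC.mul hpow
  rw [zero_add] at this
  exact this.mono (le_natDegree_of_mem_supp k hk)

/-- **`deg N_c ≤ deg q · deg p`**: in the Leibniz expansion of the Sylvester determinant over
`ℤ[X]`, each of the `deg q` columns of coefficients of `p(X − cY)` contributes degree `≤ deg p` and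
the `deg p` columns of (constant) coefficients of `q` contribute degree `0`.
[cite: Cohen1993, §3.6.2 (N has degree deg p · deg q)] -/
theorem natDegree_normSym_le (p q : ℤ[X]) (c : ℤ) :
    (normSym p q c).natDegree ≤ q.natDegree * p.natDegree := by
  set m := q.natDegree with hm
  set n := p.natDegree with hn
  set A := sylv (q.map C) (shiftPoly p c) m n with hA
  have hdet : normSym p q c = A.det := by rw [normSym, hA, det_sylv]
  rw [hdet, Matrix.det_apply']
  -- entry bounds by column
  have hcol : ∀ (i j : Fin (m + n)), (A i j).natDegree ≤ if (j : ℕ) < m then n else 0 := by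
    intro i j
    rw [hA, sylv_apply, sylvEntry]
    split_ifs with h1 h2 h3
    · exact coeffDegLE_shiftPoly p c _
    · simp
    · rw [coeff_map, natDegree_C]
    · simp
  refine natDegree_sum_le_of_forall_le _ _ fun σ _ => ?_
  refine natDegree_mul_le.trans ?_
  rw [natDegree_intCast, zero_add]
  refine (natDegree_prod_le _ _).trans ?_
  calc ∑ j : Fin (m + n), (A (σ j) j).natDegree ≤ ∑ j : Fin (m + n), (if (j : ℕ) < m then n else 0) :=
        Finset.sum_le_sum fun j _ => hcol (σ j) j
    _ = m * n := by
        rw [Fin.sum_univ_eq_sum_range (fun j => if j < m then n else 0) (m + n), Finset.sum_ite,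
          Finset.sum_const_zero, add_zero, Finset.sum_const, smul_eq_mul]
        congr 1
        have : (range (m + n)).filter (fun j => j < m) = range m := by
          ext j
          simp only [mem_filter, mem_range]
          omega
        rw [this, card_range]

end Literature.NumberTheory.NumberFields
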